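import Literature.Analysis.FluidPDE.BackwardHeatCaccioppoli
import Literature.Analysis.FluidPDE.BackwardHeatSubsolution
import Mathlib.Analysis.Calculus.BumpFunction.InnerProduct
import Mathlib.Analysis.SpecialFunctions.SmoothTransition
import HarnessLib

/-!
# Smooth parabolic cut-off profiles and their scaling

Analysis/FluidPDE support file (everything proved, no definitions) on the discharge path of the
named fact `Literature.Analysis.FluidPDE.Carleman.seregin_backwardHeat_localMax_le_L2`
(`BackwardHeatRegularity.lean`; Seregin 2014, App. A.2, Remark A.2). The local maximum estimate
localises a solution of the backward heat inequality to the future parabolic cylinder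
`[s₀, s₀ + ρ²] × B̄(y₀, ρ)` of a point `z₀ = (s₀, y₀)` with a cut-off of the form
`Ξ(s, y) = Ξ₁((s - s₀)/ρ², (y - y₀)/ρ)`; this file supplies the profile `Ξ₁` and the calculus
of the scaling, in the uncurried frame operators `dt`, `dx`, `lap`, `gradSq` of
`CarlemanCalculus.lean`. All objects are produced by existence statements (no new definitions):

* `exists_smooth_monotone_transition` — for `a < b` a smooth nondecreasing `h : ℝ → [0, 1]` with
  `h = 0` on `(-∞, a]` and `h = 1` on `[b, ∞)` (Mathlib's `Real.smoothTransition`);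
* `exists_parabolicProfile` — a smooth `Ξ₁ : ℝ × E → [0, 1]`, equal to `1` on the open set
  `{τ < 1/2, ‖v‖ < 1/2}`, vanishing unless `τ < 1` and `‖v‖ < 3/4`, with
  `|∂ₜΞ₁|, |∇ₓΞ₁|², |ΔₓΞ₁| ≤ M` everywhere (`Ξ₁(τ, v) = χ₀(τ) ψ₀(v)` with `χ₀` a smooth transition
  and `ψ₀` a `ContDiffBump`; `Ξ₁` is deliberately NOT cut off towards `τ → -∞`: for the backward
  operator the representation kernels only see the future `s > s₀`, and below `s₀` a separate
  cut-off at an arbitrarily small scale is used);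
* the **parabolic scaling** `Ξ(z) = Ξ₁((z.1 - s₀)/ρ², ρ⁻¹(z.2 - y₀))` of any `C²` profile:
  `∂ₜΞ(z) = ρ⁻² ∂ₜΞ₁(Az)`, `∂ₑΞ(z) = ρ⁻¹ ∂ₑΞ₁(Az)`, `ΔₓΞ(z) = ρ⁻² ΔₓΞ₁(Az)`,
  `|∇ₓΞ|²(z) = ρ⁻² |∇ₓΞ₁|²(Az)` (`dt_parabolicScale`, `dx_parabolicScale`, `lap_parabolicScale`,
  `gradSq_parabolicScale`), and the vanishing of all these derivatives on open sets where a
  function is constant (`dt_eq_zero_of_eventuallyEq_const`, …);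
* `exists_localisedCutoff` — **the localised cut-off** of the future cylinder of `z₀ = (s₀, y₀)`
  at scale `ρ ≤ 1` with an arbitrarily thin collar `ε` below `s₀`: a smooth `Θ : ℝ × E → [0, 1]`
  supported in `[s₀ - ε, s₀ + ρ²] × B̄(y₀, ρ)`, equal to `1` on
  `{s₀ - ε/3 < s, s - s₀ < ρ²/2, ‖y - y₀‖ < ρ/2}`, with `|∂ₜΘ|, |∇ₓΘ|², |ΔₓΘ| ≤ M/ρ²` on the
  half-space `{s > s₀ - ε/3}` (`Θ(s, y) = χ_b(s) Ξ₁((s - s₀)/ρ², (y - y₀)/ρ)` with `χ_b` a transition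
  from `0` below `s₀ - 2ε/3` to `1` above `s₀ - ε/3`; below `s₀ - ε/3` no bound uniform in `ε` holds,
  and none is needed: the kernels of the backward representation vanish there).

## References

* G. M. Lieberman, *Second order parabolic differential equations*, World Scientific 1996,
  Ch. II–IV (parabolic cylinders and cut-offs).
* O. A. Ladyženskaja, V. A. Solonnikov, N. N. Ural'ceva, *Linear and quasi-linear equations of
  parabolic type*, AMS 1968, Ch. III §§7–8.
-/

noncomputable section

open Set Function Filter Metric
open scoped Topology RealInnerProductSpace

namespace Literature.Analysis.FluidPDE

namespace Carleman

/-! ### One-dimensional smooth monotone transitions -/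

/-- **Smooth monotone transitions.** For `a < b` there is a smooth `h : ℝ → ℝ` with values in
`[0, 1]`, `h = 0` on `(-∞, a]`, `h = 1` on `[b, ∞)`, nondecreasing, with `h' ≥ 0`
(`h(s) = smoothTransition((s - a)/(b - a))`). [folklore] -/
theorem exists_smooth_monotone_transition {a b : ℝ} (hab : a < b) :
    ∃ h : ℝ → ℝ, ContDiff ℝ ((⊤ : ℕ∞) : WithTop ℕ∞) h ∧ (∀ s, 0 ≤ h s ∧ h s ≤ 1) ∧
      (∀ s, s ≤ a → h s = 0) ∧ (∀ s, b ≤ s → h s = 1) ∧ Monotone h ∧ ∀ s, 0 ≤ deriv h s := by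
  have hba : 0 < b - a := sub_pos.2 hab
  refine ⟨fun s => Real.smoothTransition ((s - a) / (b - a)), ?_, fun s =>
    ⟨Real.smoothTransition.nonneg _, Real.smoothTransition.le_one _⟩, fun s hs => ?_, fun s hs => ?_,
    ?_, fun s => ?_⟩
  · exact Real.smoothTransition.contDiff.comp ((contDiff_id.sub contDiff_const).div_const _)
  · exact Real.smoothTransition.zero_of_nonpos (div_nonpos_of_nonpos_of_nonneg (by linarith) hba.le)
  · exact Real.smoothTransition.one_of_one_le ((one_le_div hba).2 (by linarith))
  · exact Real.smoothTransition.monotone.comp fun s t hst => by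
      exact div_le_div_of_nonneg_right (by linarith) hba.le
  · exact (Real.smoothTransition.monotone.comp fun s t hst => by
      exact div_le_div_of_nonneg_right (by linarith) hba.le).deriv_nonneg

/-! ### Derivatives of functions of one variable only, and of locally constant functions -/

section OneVariable

variable {E : Type*} [NormedAddCommGroup E] [InnerProductSpace ℝ E]
variable {G : Type*} [NormedAddCommGroup G] [NormedSpace ℝ G]

/-- Derivative of a space-only function: `D(g ∘ x)(z) v = Dg(z.2) v.2`. [folklore] -/
theorem fderiv_comp_snd_apply {g : E → G} {z : ℝ × E} (hg : DifferentiableAt ℝ g z.2)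
    (v : ℝ × E) : fderiv ℝ (fun y : ℝ × E => g y.2) z v = fderiv ℝ g z.2 v.2 := by
  have h : HasFDerivAt (fun y : ℝ × E => g y.2) ((fderiv ℝ g z.2).comp (ContinuousLinearMap.snd ℝ ℝ E)) z :=
    hg.hasFDerivAt.comp z hasFDerivAt_snd
  rw [h.fderiv]
  rfl

/-- A function that is eventually constant near `z` has zero derivative there. [folklore] -/
theorem fderiv_eq_zero_of_eventuallyEq_const {V : ℝ × E → G} {z : ℝ × E} {c : G}
    (h : V =ᶠ[𝓝 z] fun _ => c) : fderiv ℝ V z = 0 := by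
  rw [h.fderiv_eq]
  exact fderiv_const_apply c

/-- `∂ₜV(z) = 0` if `V` is constant near `z`. [folklore] -/
theorem dt_eq_zero_of_eventuallyEq_const {V : ℝ × E → G} {z : ℝ × E} {c : G}
    (h : V =ᶠ[𝓝 z] fun _ => c) : dt V z = 0 := by
  rw [dt_apply, fderiv_eq_zero_of_eventuallyEq_const h]
  rfl

/-- `∂ₑV(z) = 0` if `V` is constant near `z`. [folklore] -/
theorem dx_eq_zero_of_eventuallyEq_const {V : ℝ × E → G} {z : ℝ × E} {c : G}
    (h : V =ᶠ[𝓝 z] fun _ => c) (e : E) : dx e V z = 0 := by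
  rw [dx_apply, fderiv_eq_zero_of_eventuallyEq_const h]
  rfl

/-- If `V` is constant on an open set `O`, then `∂ₑV = 0` on `O`, hence `∂ₑ∂ₑ'V(z) = 0` for
`z ∈ O`. [folklore] -/
theorem dx_dx_eq_zero_of_eqOn_const {V : ℝ × E → G} {O : Set (ℝ × E)} (hO : IsOpen O) {c : G}
    (h : EqOn V (fun _ => c) O) {z : ℝ × E} (hz : z ∈ O) (e e' : E) : dx e (dx e' V) z = 0 := by
  have h1 : dx e' V =ᶠ[𝓝 z] fun _ => (0 : G) := by
    filter_upwards [hO.mem_nhds hz] with w hw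
    exact dx_eq_zero_of_eventuallyEq_const (h.eventuallyEq_of_mem (hO.mem_nhds hw)) e'
  exact dx_eq_zero_of_eventuallyEq_const h1 e

/-- If `V` is constant on an open set `O`, then `∂ₜV`, `ΔₓV` and `|∇ₓV|²` vanish on `O`.
[folklore] -/
theorem dt_lap_gradSq_eq_zero_of_eqOn_const [FiniteDimensional ℝ E] {V : ℝ × E → G}
    {O : Set (ℝ × E)} (hO : IsOpen O) {c : G} (h : EqOn V (fun _ => c) O) {z : ℝ × E}
    (hz : z ∈ O) : dt V z = 0 ∧ lap V z = 0 ∧ gradSq V z = 0 := by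
  have hev : V =ᶠ[𝓝 z] fun _ => c := h.eventuallyEq_of_mem (hO.mem_nhds hz)
  refine ⟨dt_eq_zero_of_eventuallyEq_const hev, ?_, ?_⟩
  · simp only [lap]
    exact Finset.sum_eq_zero fun i _ => dx_dx_eq_zero_of_eqOn_const hO h hz _ _
  · simp only [gradSq]
    exact Finset.sum_eq_zero fun i _ => by rw [dx_eq_zero_of_eventuallyEq_const hev]; simp

end OneVariable

/-! ### The parabolic profile -/

section Profile

variable {E : Type*} [NormedAddCommGroup E] [InnerProductSpace ℝ E] [FiniteDimensional ℝ E]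

/-- A global bound for a continuous function on `ℝ` that vanishes off `[0, 1]`. [folklore] -/
theorem exists_bound_of_eq_zero_off_Icc {f : ℝ → ℝ} (hf : Continuous f)
    (h0 : ∀ τ, τ ∉ Icc (0 : ℝ) 1 → f τ = 0) : ∃ K : ℝ, 0 ≤ K ∧ ∀ τ, |f τ| ≤ K := by
  obtain ⟨K, hK⟩ := isCompact_Icc.exists_bound_of_continuousOn (s := Icc (0 : ℝ) 1) hf.continuousOn
  refine ⟨max K 0, le_max_right _ _, fun τ => ?_⟩
  by_cases hτ : τ ∈ Icc (0 : ℝ) 1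
  · exact ((Real.norm_eq_abs _).symm.le.trans (hK τ hτ)).trans (le_max_left _ _)
  · rw [h0 τ hτ, abs_zero]; exact le_max_right _ _

/-- **The parabolic cut-off profile.** There are a smooth `Ξ₁ : ℝ × E → [0, 1]` and `M ≥ 0`
with: `Ξ₁ = 1` on the open set `{τ < 1/2} × {‖v‖ < 1/2}`; `Ξ₁(τ, v) ≠ 0` only if `τ < 1` and
`‖v‖ < 3/4`; and `|∂ₜΞ₁| ≤ M`, `|∇ₓΞ₁|² ≤ M`, `|ΔₓΞ₁| ≤ M` everywhere
(`Ξ₁(τ, v) = χ₀(τ) ψ₀(v)`, `χ₀` a smooth transition from `1` on `τ ≤ 1/2` to `0` on `τ ≥ 1`, `ψ₀` a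
smooth bump equal to `1` on `B̄(0, 1/2)` and supported in `B̄(0, 3/4)`). [folklore] -/
theorem exists_parabolicProfile :
    ∃ Ξ₁ : ℝ × E → ℝ, ∃ M : ℝ, 0 ≤ M ∧ ContDiff ℝ ((⊤ : ℕ∞) : WithTop ℕ∞) Ξ₁ ∧
      (∀ z, 0 ≤ Ξ₁ z ∧ Ξ₁ z ≤ 1) ∧
      (∀ z : ℝ × E, z.1 < 1 / 2 → ‖z.2‖ < 1 / 2 → Ξ₁ z = 1) ∧
      (∀ z : ℝ × E, Ξ₁ z ≠ 0 → z.1 < 1 ∧ ‖z.2‖ < 3 / 4) ∧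
      (∀ z, |dt Ξ₁ z| ≤ M ∧ gradSq Ξ₁ z ≤ M ∧ |lap Ξ₁ z| ≤ M) := by
  -- the two factors
  obtain ⟨χ, hχs, hχ01, hχ0, hχ1, -, -⟩ := exists_smooth_monotone_transition (a := (-1 : ℝ))
    (b := -(1 / 2)) (by norm_num)
  -- `χ₀ τ = χ (-τ)`: equal to `1` for `τ ≤ 1/2`, to `0` for `τ ≥ 1`
  set χ₀ : ℝ → ℝ := fun τ => χ (-τ) with hχ₀
  have hχ₀s : ContDiff ℝ ((⊤ : ℕ∞) : WithTop ℕ∞) χ₀ := hχs.comp contDiff_neg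
  have hχ₀1 : ContDiff ℝ 1 χ₀ := hχ₀s.of_le (by exact_mod_cast le_top)
  have hχ₀one : ∀ τ, τ ≤ 1 / 2 → χ₀ τ = 1 := fun τ hτ => hχ1 _ (by linarith)
  have hχ₀zero : ∀ τ, 1 ≤ τ → χ₀ τ = 0 := fun τ hτ => hχ0 _ (by linarith)
  let ψ₀ : ContDiffBump (0 : E) := ⟨1 / 2, 3 / 4, by norm_num, by norm_num⟩
  have hψs : ContDiff ℝ ((⊤ : ℕ∞) : WithTop ℕ∞) (ψ₀ : E → ℝ) := ψ₀.contDiff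
  have hψ2 : ContDiff ℝ 2 (ψ₀ : E → ℝ) := ψ₀.contDiff
  -- the space-time factors
  set p : ℝ × E → ℝ := fun z => χ₀ z.1 with hp
  set q : ℝ × E → ℝ := fun z => ψ₀ z.2 with hq
  have hps : ContDiff ℝ ((⊤ : ℕ∞) : WithTop ℕ∞) p := hχ₀s.comp contDiff_fst
  have hqs : ContDiff ℝ ((⊤ : ℕ∞) : WithTop ℕ∞) q := hψs.comp contDiff_snd
  have hp2 : ContDiff ℝ 2 p := contDiff_two_of_top hps
  have hq2 : ContDiff ℝ 2 q := contDiff_two_of_top hqs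
  have hp1 : ContDiff ℝ 1 p := hp2.of_le (by norm_num)
  have hq1 : ContDiff ℝ 1 q := hq2.of_le (by norm_num)
  have hqd : DifferentiableOn ℝ q univ := (hq1.differentiable one_ne_zero).differentiableOn
  have hψd : ∀ x : E, DifferentiableAt ℝ (ψ₀ : E → ℝ) x := fun x => hψ2.differentiable (by norm_num) x
  -- first derivatives of the factors
  have hdtq : ∀ z, dt q z = 0 := fun z => by
    rw [dt_apply, hq, fderiv_comp_snd_apply (hψd _)]; simp
  have hdxp : ∀ e z, dx e p z = 0 := fun e z => by
    rw [dx_apply, hp, fderiv_comp_fst_apply hχ₀1]; simp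
  have hdtp : ∀ z, dt p z = deriv χ₀ z.1 := fun z => by
    rw [dt_apply, hp, fderiv_comp_fst_apply hχ₀1]; simp
  have hdxq : ∀ e z, dx e q z = fderiv ℝ (ψ₀ : E → ℝ) z.2 e := fun e z => by
    rw [dx_apply, hq, fderiv_comp_snd_apply (hψd _)]
  have hdxdxq : ∀ e z, dx e (dx e q) z = fderiv ℝ (fun x => fderiv ℝ (ψ₀ : E → ℝ) x e) z.2 e := by
    intro e z
    have hfun : dx e q = fun y : ℝ × E => (fun x => fderiv ℝ (ψ₀ : E → ℝ) x e) y.2 :=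
      funext fun y => hdxq e y
    have hd1 : ContDiff ℝ 1 fun x => fderiv ℝ (ψ₀ : E → ℝ) x e :=
      (hψ2.fderiv_right (m := 1) le_rfl).clm_apply contDiff_const
    rw [dx_apply, hfun, fderiv_comp_snd_apply ((hd1.differentiable one_ne_zero) _)]
  have hlapp : ∀ z, lap p z = 0 := fun z => by
    simp only [lap]
    refine Finset.sum_eq_zero fun i _ => ?_
    have : dx (stdOrthonormalBasis ℝ E i) p = fun _ => 0 := funext fun y => hdxp _ y
    rw [dx_apply, this]; simp
  -- the profile and the Leibniz formulas
  set Ξ₁ : ℝ × E → ℝ := fun z => p z • q z with hΞ₁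
  have hsupp : tsupport p ⊆ univ := subset_univ _
  have eq_dt : ∀ z, dt Ξ₁ z = deriv χ₀ z.1 * q z := fun z => by
    rw [hΞ₁, dt_cutoff_smul isOpen_univ hp1 hsupp hqd z, hdtq, hdtp]; simp
  have eq_dx : ∀ e z, dx e Ξ₁ z = p z * dx e q z := fun e z => by
    rw [hΞ₁, dx_cutoff_smul isOpen_univ hp1 hsupp hqd e z, hdxp]; simp
  have eq_lap : ∀ z, lap Ξ₁ z = p z * lap q z := fun z => by
    rw [hΞ₁, lap_cutoff_smul isOpen_univ hp2 hsupp hq2.contDiffOn z, hlapp]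
    simp only [hdxp, smul_eq_mul, zero_mul, Finset.sum_const_zero, mul_zero, add_zero]
  have eq_gradSq : ∀ z, gradSq Ξ₁ z = p z ^ 2 * gradSq q z := fun z => by
    rw [hΞ₁, gradSq_cutoff_smul isOpen_univ hp1 hsupp hqd z]
    simp only [hdxp, smul_eq_mul, zero_mul, add_zero, Real.norm_eq_abs, sq_abs, mul_pow, gradSq,
      Finset.mul_sum]
  -- bounds of the factors
  have hp01 : ∀ z, 0 ≤ p z ∧ p z ≤ 1 := fun z => hχ01 _
  have hq01 : ∀ z, 0 ≤ q z ∧ q z ≤ 1 := fun z => ⟨ψ₀.nonneg, ψ₀.le_one⟩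
  -- `|χ₀'| ≤ K₁`
  obtain ⟨K₁, hK₁0, hK₁⟩ : ∃ K : ℝ, 0 ≤ K ∧ ∀ τ, |deriv χ₀ τ| ≤ K := by
    refine exists_bound_of_eq_zero_off_Icc (hχ₀1.continuous_deriv le_rfl) fun τ hτ => ?_
    rcases not_and_or.1 (fun h => hτ ⟨h.1, h.2⟩ : ¬(0 ≤ τ ∧ τ ≤ 1)) with h | h
    · -- `τ < 0`: `χ₀ = 1` near `τ`
      have hev : χ₀ =ᶠ[𝓝 τ] fun _ => 1 := by
        filter_upwards [Iio_mem_nhds (show τ < 1 / 2 by linarith)] with σ hσ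
        exact hχ₀one σ (le_of_lt hσ)
      rw [hev.deriv_eq]; exact deriv_const τ 1
    · have hev : χ₀ =ᶠ[𝓝 τ] fun _ => 0 := by
        filter_upwards [Ioi_mem_nhds (show 1 < τ by linarith)] with σ hσ
        exact hχ₀zero σ (le_of_lt hσ)
      rw [hev.deriv_eq]; exact deriv_const τ 0
  -- `‖Dψ₀‖ ≤ K₂`
  obtain ⟨K₂, hK₂⟩ := (hψ2.continuous_fderiv (by norm_num)).bounded_above_of_compact_support
    (ψ₀.hasCompactSupport.fderiv (𝕜 := ℝ))
  have hK₂0 : 0 ≤ K₂ := (norm_nonneg _).trans (hK₂ 0)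
  -- `|∂ᵢ∂ᵢψ₀| ≤ K₃ i`
  have hK₃ : ∀ e : E, ∃ K : ℝ, ∀ x : E, ‖fderiv ℝ (fun x => fderiv ℝ (ψ₀ : E → ℝ) x e) x‖ ≤ K := by
    intro e
    have hd1 : ContDiff ℝ 1 fun x => fderiv ℝ (ψ₀ : E → ℝ) x e :=
      (hψ2.fderiv_right (m := 1) le_rfl).clm_apply contDiff_const
    have hc1 : HasCompactSupport fun x => fderiv ℝ (ψ₀ : E → ℝ) x e :=
      ψ₀.hasCompactSupport.fderiv_apply (𝕜 := ℝ) e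
    exact (hd1.continuous_fderiv one_ne_zero).bounded_above_of_compact_support (hc1.fderiv (𝕜 := ℝ))
  choose K₃ hK₃ using hK₃
  set b := stdOrthonormalBasis ℝ E with hb
  set M : ℝ := K₁ + Module.finrank ℝ E * K₂ ^ 2 + ∑ i, K₃ (b i) with hM
  have hK₃0 : ∀ e, 0 ≤ K₃ e := fun e => (norm_nonneg _).trans (hK₃ e 0)
  have hM1 : K₁ ≤ M := by
    have : 0 ≤ ∑ i, K₃ (b i) := Finset.sum_nonneg fun i _ => hK₃0 _
    rw [hM]; nlinarith [sq_nonneg K₂, Nat.cast_nonneg (α := ℝ) (Module.finrank ℝ E)]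
  have hM2 : (Module.finrank ℝ E : ℝ) * K₂ ^ 2 ≤ M := by
    have : 0 ≤ ∑ i, K₃ (b i) := Finset.sum_nonneg fun i _ => hK₃0 _
    rw [hM]; linarith
  have hM3 : ∑ i, K₃ (b i) ≤ M := by
    rw [hM]; nlinarith [sq_nonneg K₂, Nat.cast_nonneg (α := ℝ) (Module.finrank ℝ E)]
  refine ⟨Ξ₁, M, hK₁0.trans hM1, hps.smul hqs, fun z => ?_, fun z h1 h2 => ?_, fun z hz => ?_,
    fun z => ⟨?_, ?_, ?_⟩⟩
  · exact ⟨mul_nonneg (hp01 z).1 (hq01 z).1, mul_le_one₀ (hp01 z).2 (hq01 z).1 (hq01 z).2⟩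
  · show p z * q z = 1
    rw [show p z = 1 from hχ₀one _ h1.le, show q z = 1 from ψ₀.one_of_mem_closedBall (by
      rw [mem_closedBall, dist_zero_right]
      show ‖z.2‖ ≤ 1 / 2
      exact h2.le), one_mul]
  · have hpz : p z ≠ 0 := left_ne_zero_of_mul hz
    have hqz : q z ≠ 0 := right_ne_zero_of_mul hz
    constructor
    · by_contra h
      exact hpz (hχ₀zero _ (not_lt.1 h))
    · by_contra h
      exact hqz (ψ₀.zero_of_le_dist (by
        rw [dist_zero_right]
        show (3 : ℝ) / 4 ≤ ‖z.2‖
        exact not_lt.1 h))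
  · rw [eq_dt, abs_mul]
    calc |deriv χ₀ z.1| * |q z| ≤ K₁ * 1 :=
          mul_le_mul (hK₁ _) (by rw [abs_of_nonneg (hq01 z).1]; exact (hq01 z).2) (abs_nonneg _) hK₁0
      _ ≤ M := by rw [mul_one]; exact hM1
  · rw [eq_gradSq]
    have hgq : gradSq q z ≤ Module.finrank ℝ E * K₂ ^ 2 := by
      calc gradSq q z = ∑ i, ‖fderiv ℝ (ψ₀ : E → ℝ) z.2 (b i)‖ ^ 2 := by
            simp only [gradSq, hdxq, hb]
        _ ≤ ∑ _i : Fin (Module.finrank ℝ E), K₂ ^ 2 := Finset.sum_le_sum fun i _ => by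
            have h := (fderiv ℝ (ψ₀ : E → ℝ) z.2).le_opNorm (b i)
            rw [b.orthonormal.1 i, mul_one] at h
            exact pow_le_pow_left₀ (norm_nonneg _) (h.trans (hK₂ _)) 2
        _ = Module.finrank ℝ E * K₂ ^ 2 := by simp
    calc p z ^ 2 * gradSq q z ≤ 1 * (Module.finrank ℝ E * K₂ ^ 2) :=
          mul_le_mul (pow_le_one₀ (hp01 z).1 (hp01 z).2) hgq (gradSq_nonneg _ _) zero_le_one
      _ ≤ M := by rw [one_mul]; exact hM2
  · rw [eq_lap, abs_mul]
    have hlq : |lap q z| ≤ ∑ i, K₃ (b i) := by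
      calc |lap q z| = |∑ i, dx (b i) (dx (b i) q) z| := by rw [lap]
        _ ≤ ∑ i, |dx (b i) (dx (b i) q) z| := Finset.abs_sum_le_sum_abs _ _
        _ ≤ ∑ i, K₃ (b i) := Finset.sum_le_sum fun i _ => by
            rw [hdxdxq]
            have h := (fderiv ℝ (fun x => fderiv ℝ (ψ₀ : E → ℝ) x (b i)) z.2).le_opNorm (b i)
            rw [b.orthonormal.1 i, mul_one] at h
            exact ((Real.norm_eq_abs _).symm.le.trans h).trans (hK₃ _ _)
    calc |p z| * |lap q z| ≤ 1 * ∑ i, K₃ (b i) :=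
          mul_le_mul (by rw [abs_of_nonneg (hp01 z).1]; exact (hp01 z).2) hlq (abs_nonneg _) zero_le_one
      _ ≤ M := by rw [one_mul]; exact hM3

end Profile

/-! ### Parabolic scaling -/

section Scaling

variable {E : Type*} [NormedAddCommGroup E] [InnerProductSpace ℝ E]
variable {G : Type*} [NormedAddCommGroup G] [NormedSpace ℝ G]
variable {V : ℝ × E → G} {s₀ ρ : ℝ} {y₀ : E}

/-- The linear part of the parabolic scaling `z ↦ ((z.1 - s₀)/ρ², ρ⁻¹(z.2 - y₀))`. [folklore] -/
theorem parabolicScaleCLM_apply (ρ : ℝ) (w : ℝ × E) :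
    (((ρ ^ 2)⁻¹ • ContinuousLinearMap.fst ℝ ℝ E).prod (ρ⁻¹ • ContinuousLinearMap.snd ℝ ℝ E)) w =
      (w.1 / ρ ^ 2, ρ⁻¹ • w.2) := by
  simp [div_eq_inv_mul]

/-- The parabolic scaling has derivative its linear part. [folklore] -/
theorem hasFDerivAt_parabolicScale (s₀ ρ : ℝ) (y₀ : E) (z : ℝ × E) :
    HasFDerivAt (fun w : ℝ × E => ((w.1 - s₀) / ρ ^ 2, ρ⁻¹ • (w.2 - y₀)))
      (((ρ ^ 2)⁻¹ • ContinuousLinearMap.fst ℝ ℝ E).prod (ρ⁻¹ • ContinuousLinearMap.snd ℝ ℝ E)) z := by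
  set L := ((ρ ^ 2)⁻¹ • ContinuousLinearMap.fst ℝ ℝ E).prod (ρ⁻¹ • ContinuousLinearMap.snd ℝ ℝ E)
  have hfun : (fun w : ℝ × E => ((w.1 - s₀) / ρ ^ 2, ρ⁻¹ • (w.2 - y₀))) = fun w => L (w - (s₀, y₀)) := by
    funext w
    rw [parabolicScaleCLM_apply]
    rfl
  rw [hfun]
  have h2 := L.hasFDerivAt.comp z ((hasFDerivAt_id z).sub_const (s₀, y₀))
  rw [ContinuousLinearMap.comp_id] at h2
  exact h2

/-- **Chain rule for the parabolic scaling**: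
`D(V ∘ A)(z) w = DV(Az) (w.1/ρ², ρ⁻¹ w.2)`. [folklore] -/
theorem fderiv_parabolicScale_apply {z : ℝ × E}
    (hV : DifferentiableAt ℝ V ((z.1 - s₀) / ρ ^ 2, ρ⁻¹ • (z.2 - y₀))) (w : ℝ × E) :
    fderiv ℝ (fun w : ℝ × E => V ((w.1 - s₀) / ρ ^ 2, ρ⁻¹ • (w.2 - y₀))) z w =
      fderiv ℝ V ((z.1 - s₀) / ρ ^ 2, ρ⁻¹ • (z.2 - y₀)) (w.1 / ρ ^ 2, ρ⁻¹ • w.2) := by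
  have h : HasFDerivAt (fun w : ℝ × E => V ((w.1 - s₀) / ρ ^ 2, ρ⁻¹ • (w.2 - y₀)))
      ((fderiv ℝ V ((z.1 - s₀) / ρ ^ 2, ρ⁻¹ • (z.2 - y₀))).comp
        (((ρ ^ 2)⁻¹ • ContinuousLinearMap.fst ℝ ℝ E).prod (ρ⁻¹ • ContinuousLinearMap.snd ℝ ℝ E))) z :=
    hV.hasFDerivAt.comp z (hasFDerivAt_parabolicScale s₀ ρ y₀ z)
  rw [h.fderiv, ContinuousLinearMap.comp_apply, parabolicScaleCLM_apply]

/-- `∂ₜ(V ∘ A)(z) = ρ⁻² ∂ₜV(Az)`. [folklore] -/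
theorem dt_parabolicScale {z : ℝ × E}
    (hV : DifferentiableAt ℝ V ((z.1 - s₀) / ρ ^ 2, ρ⁻¹ • (z.2 - y₀))) :
    dt (fun w : ℝ × E => V ((w.1 - s₀) / ρ ^ 2, ρ⁻¹ • (w.2 - y₀))) z =
      (ρ ^ 2)⁻¹ • dt V ((z.1 - s₀) / ρ ^ 2, ρ⁻¹ • (z.2 - y₀)) := by
  rw [dt_apply, dt_apply, fderiv_parabolicScale_apply hV, ← map_smul]
  congr 1
  ext <;> simp

/-- `∂ₑ(V ∘ A)(z) = ρ⁻¹ ∂ₑV(Az)`. [folklore] -/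
theorem dx_parabolicScale {z : ℝ × E}
    (hV : DifferentiableAt ℝ V ((z.1 - s₀) / ρ ^ 2, ρ⁻¹ • (z.2 - y₀))) (e : E) :
    dx e (fun w : ℝ × E => V ((w.1 - s₀) / ρ ^ 2, ρ⁻¹ • (w.2 - y₀))) z =
      ρ⁻¹ • dx e V ((z.1 - s₀) / ρ ^ 2, ρ⁻¹ • (z.2 - y₀)) := by
  rw [dx_apply, dx_apply, fderiv_parabolicScale_apply hV, ← map_smul]
  congr 1
  ext <;> simp

/-- `∂ₑ(V ∘ A) = ρ⁻¹ • (∂ₑV) ∘ A` for an everywhere differentiable `V`. [folklore] -/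
theorem dx_parabolicScale_eq (hV : Differentiable ℝ V) (e : E) :
    dx e (fun w : ℝ × E => V ((w.1 - s₀) / ρ ^ 2, ρ⁻¹ • (w.2 - y₀))) =
      fun z => ρ⁻¹ • dx e V ((z.1 - s₀) / ρ ^ 2, ρ⁻¹ • (z.2 - y₀)) :=
  funext fun _ => dx_parabolicScale (hV _) e

/-- `∂ₑ∂ₑ'(V ∘ A)(z) = ρ⁻² ∂ₑ∂ₑ'V(Az)` for `V ∈ C²`. [folklore] -/
theorem dx_dx_parabolicScale (hV : ContDiff ℝ 2 V) (e e' : E) (z : ℝ × E) :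
    dx e (dx e' (fun w : ℝ × E => V ((w.1 - s₀) / ρ ^ 2, ρ⁻¹ • (w.2 - y₀)))) z =
      (ρ ^ 2)⁻¹ • dx e (dx e' V) ((z.1 - s₀) / ρ ^ 2, ρ⁻¹ • (z.2 - y₀)) := by
  have hd : Differentiable ℝ V := hV.differentiable (by norm_num)
  have hd1 : Differentiable ℝ (dx e' V) :=
    (contDiff_one_dx_of_contDiff_two hV e').differentiable one_ne_zero
  have hdiff : DifferentiableAt ℝ
      (fun w : ℝ × E => dx e' V ((w.1 - s₀) / ρ ^ 2, ρ⁻¹ • (w.2 - y₀))) z :=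
    (hd1 _).comp z (hasFDerivAt_parabolicScale s₀ ρ y₀ z).differentiableAt
  rw [dx_parabolicScale_eq hd e', dx_apply, fderiv_fun_const_smul hdiff ρ⁻¹, FunLike.coe_smul,
    Pi.smul_apply]
  show ρ⁻¹ • dx e (fun w : ℝ × E => dx e' V ((w.1 - s₀) / ρ ^ 2, ρ⁻¹ • (w.2 - y₀))) z = _
  rw [dx_parabolicScale (hd1 _) e, smul_smul, ← mul_inv, ← sq]

/-- `Δₓ(V ∘ A)(z) = ρ⁻² ΔₓV(Az)` for `V ∈ C²`. [folklore] -/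
theorem lap_parabolicScale [FiniteDimensional ℝ E] (hV : ContDiff ℝ 2 V) (z : ℝ × E) :
    lap (fun w : ℝ × E => V ((w.1 - s₀) / ρ ^ 2, ρ⁻¹ • (w.2 - y₀))) z =
      (ρ ^ 2)⁻¹ • lap V ((z.1 - s₀) / ρ ^ 2, ρ⁻¹ • (z.2 - y₀)) := by
  simp only [lap, dx_dx_parabolicScale hV, Finset.smul_sum]

/-- `|∇ₓ(V ∘ A)|²(z) = ρ⁻² |∇ₓV|²(Az)`. [folklore] -/
theorem gradSq_parabolicScale [FiniteDimensional ℝ E] (hV : Differentiable ℝ V) (z : ℝ × E) :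
    gradSq (fun w : ℝ × E => V ((w.1 - s₀) / ρ ^ 2, ρ⁻¹ • (w.2 - y₀))) z =
      (ρ ^ 2)⁻¹ * gradSq V ((z.1 - s₀) / ρ ^ 2, ρ⁻¹ • (z.2 - y₀)) := by
  simp only [gradSq, dx_parabolicScale (hV _), norm_smul, mul_pow, Finset.mul_sum, norm_inv,
    Real.norm_eq_abs, inv_pow, sq_abs]

/-- Smoothness of the scaled function. [folklore] -/
theorem contDiff_parabolicScale {n : WithTop ℕ∞} (hV : ContDiff ℝ n V) :
    ContDiff ℝ n fun w : ℝ × E => V ((w.1 - s₀) / ρ ^ 2, ρ⁻¹ • (w.2 - y₀)) :=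
  hV.comp (((contDiff_fst.sub contDiff_const).div_const _).prodMk
    ((contDiff_snd.sub contDiff_const).const_smul _))

end Scaling

/-! ### The localised cut-off of a future parabolic cylinder -/

section Localised

variable {E : Type*} [NormedAddCommGroup E] [InnerProductSpace ℝ E] [FiniteDimensional ℝ E]

/-- **The localised cut-off.** Let `Ξ₁` be a parabolic profile with derivative bound `M` (as
produced by `exists_parabolicProfile`), `z₀ = (s₀, y₀)`, `0 < ρ`, `0 < ε`. There is a smooth
compactly supported `Θ : ℝ × E → [0, 1]` with `tsupport Θ ⊆ [s₀ - ε, s₀ + ρ²] × B̄(y₀, ρ)`,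
`Θ = 1` on `{s₀ - ε/3 < s, s - s₀ < ρ²/2, ‖y - y₀‖ < ρ/2}`, and
`|∂ₜΘ| ≤ M/ρ²`, `|∇ₓΘ|² ≤ M/ρ²`, `|ΔₓΘ| ≤ M/ρ²` at every point with `s > s₀ - ε/3`. [folklore] -/
theorem exists_localisedCutoff {Ξ₁ : ℝ × E → ℝ} {M : ℝ}
    (hΞs : ContDiff ℝ ((⊤ : ℕ∞) : WithTop ℕ∞) Ξ₁) (hΞ01 : ∀ z, 0 ≤ Ξ₁ z ∧ Ξ₁ z ≤ 1)
    (hΞone : ∀ z : ℝ × E, z.1 < 1 / 2 → ‖z.2‖ < 1 / 2 → Ξ₁ z = 1)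
    (hΞsupp : ∀ z : ℝ × E, Ξ₁ z ≠ 0 → z.1 < 1 ∧ ‖z.2‖ < 3 / 4)
    (hΞM : ∀ z, |dt Ξ₁ z| ≤ M ∧ gradSq Ξ₁ z ≤ M ∧ |lap Ξ₁ z| ≤ M)
    (s₀ : ℝ) (y₀ : E) {ρ ε : ℝ} (hρ : 0 < ρ) (hε : 0 < ε) :
    ∃ Θ : ℝ × E → ℝ, ContDiff ℝ ((⊤ : ℕ∞) : WithTop ℕ∞) Θ ∧ HasCompactSupport Θ ∧
      tsupport Θ ⊆ Icc (s₀ - ε) (s₀ + ρ ^ 2) ×ˢ closedBall y₀ ρ ∧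
      (∀ z, 0 ≤ Θ z ∧ Θ z ≤ 1) ∧
      (∀ z : ℝ × E, s₀ - ε / 3 < z.1 → z.1 - s₀ < ρ ^ 2 / 2 → ‖z.2 - y₀‖ < ρ / 2 → Θ z = 1) ∧
      (∀ z : ℝ × E, s₀ - ε / 3 < z.1 →
        |dt Θ z| ≤ M / ρ ^ 2 ∧ gradSq Θ z ≤ M / ρ ^ 2 ∧ |lap Θ z| ≤ M / ρ ^ 2) := by
  obtain ⟨χ, hχs, hχ01, hχ0, hχ1, -, -⟩ := exists_smooth_monotone_transition
    (a := s₀ - 2 * ε / 3) (b := s₀ - ε / 3) (by linarith)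
  have hρ2 : 0 < ρ ^ 2 := by positivity
  -- the scaled profile and the cut-off
  set Ξ : ℝ × E → ℝ := fun w => Ξ₁ ((w.1 - s₀) / ρ ^ 2, ρ⁻¹ • (w.2 - y₀)) with hΞ
  have hΞsm : ContDiff ℝ ((⊤ : ℕ∞) : WithTop ℕ∞) Ξ := contDiff_parabolicScale hΞs
  have hΞ2 : ContDiff ℝ 2 Ξ₁ := contDiff_two_of_top hΞs
  have hΞd : Differentiable ℝ Ξ₁ := hΞ2.differentiable (by norm_num)
  set Θ : ℝ × E → ℝ := fun w => χ w.1 * Ξ w with hΘ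
  have hΘs : ContDiff ℝ ((⊤ : ℕ∞) : WithTop ℕ∞) Θ := (hχs.comp contDiff_fst).mul hΞsm
  -- support
  set K' : Set (ℝ × E) := Icc (s₀ - 2 * ε / 3) (s₀ + ρ ^ 2) ×ˢ closedBall y₀ (3 * ρ / 4) with hK'
  have hK'c : IsCompact K' := isCompact_Icc.prod (isCompact_closedBall _ _)
  have hsuppK' : support Θ ⊆ K' := by
    intro w hw
    rw [mem_support] at hw
    have h1 : χ w.1 ≠ 0 := left_ne_zero_of_mul hw
    have h2 : Ξ w ≠ 0 := right_ne_zero_of_mul hw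
    obtain ⟨h3, h4⟩ := hΞsupp _ h2
    refine ⟨⟨?_, ?_⟩, ?_⟩
    · by_contra h
      exact h1 (hχ0 _ (le_of_lt (not_le.1 h)))
    · have : (w.1 - s₀) / ρ ^ 2 < 1 := h3
      rw [div_lt_one hρ2] at this
      linarith
    · have : ‖ρ⁻¹ • (w.2 - y₀)‖ < 3 / 4 := h4
      rw [norm_smul, norm_inv, Real.norm_eq_abs, abs_of_pos hρ, ← div_eq_inv_mul,
        div_lt_iff₀ hρ] at this
      rw [mem_closedBall, dist_eq_norm]
      linarith
  have htsupp : tsupport Θ ⊆ K' := closure_minimal hsuppK' hK'c.isClosed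
  have hK'box : K' ⊆ Icc (s₀ - ε) (s₀ + ρ ^ 2) ×ˢ closedBall y₀ ρ :=
    prod_mono (Icc_subset_Icc (by linarith) le_rfl) (closedBall_subset_closedBall (by linarith))
  -- `Θ = Ξ` on the half-space `s > s₀ - ε/3`
  set H : Set (ℝ × E) := {w | s₀ - ε / 3 < w.1} with hH
  have hHo : IsOpen H := isOpen_lt continuous_const continuous_fst
  have hΘΞ : ∀ w ∈ H, Θ w = Ξ w := fun w hw => by
    show χ w.1 * Ξ w = Ξ w
    rw [hχ1 _ (le_of_lt hw), one_mul]
  refine ⟨Θ, hΘs, IsCompact.of_isClosed_subset hK'c (isClosed_tsupport _) htsupp,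
    htsupp.trans hK'box, fun z => ?_, fun z h1 h2 h3 => ?_, fun z hz => ?_⟩
  · exact ⟨mul_nonneg (hχ01 _).1 (hΞ01 _).1, mul_le_one₀ (hχ01 _).2 (hΞ01 _).1 (hΞ01 _).2⟩
  · rw [hΘΞ z h1]
    refine hΞone _ ?_ ?_
    · show (z.1 - s₀) / ρ ^ 2 < 1 / 2
      rw [div_lt_iff₀ hρ2]; linarith
    · show ‖ρ⁻¹ • (z.2 - y₀)‖ < 1 / 2
      rw [norm_smul, norm_inv, Real.norm_eq_abs, abs_of_pos hρ, ← div_eq_inv_mul, div_lt_iff₀ hρ]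
      linarith
  · obtain ⟨edt, -, -, elap, egs⟩ := frame_eq_of_eventuallyEq hHo hz hΘΞ
    obtain ⟨bdt, bgs, blap⟩ := hΞM ((z.1 - s₀) / ρ ^ 2, ρ⁻¹ • (z.2 - y₀))
    have hinv : (ρ ^ 2)⁻¹ = 1 / ρ ^ 2 := (one_div _).symm
    refine ⟨?_, ?_, ?_⟩
    · rw [edt, hΞ, dt_parabolicScale (hΞd _), smul_eq_mul, abs_mul, abs_of_pos (inv_pos.2 hρ2),
        hinv, one_div_mul_eq_div]
      exact div_le_div_of_nonneg_right bdt hρ2.le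
    · rw [egs, hΞ, gradSq_parabolicScale hΞd, hinv, one_div_mul_eq_div]
      exact div_le_div_of_nonneg_right bgs hρ2.le
    · rw [elap, hΞ, lap_parabolicScale hΞ2, smul_eq_mul, abs_mul, abs_of_pos (inv_pos.2 hρ2),
        hinv, one_div_mul_eq_div]
      exact div_le_div_of_nonneg_right blap hρ2.le

end Localised

end Carleman

end Literature.Analysis.FluidPDE
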